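import Summits.NavierStokesRegularity.NavierStokesRegularity.Theorems.TypeILiouvilleTypeIliouvilleNoTypeIIEternalEnergyLiouvilleExtremal
import Summits.NavierStokesRegularity.NavierStokesRegularity.Theorems.TypeILiouvilleTypeIliouvilleNoTypeIIEternalEnergyLiouvilleForwardQuiescence
import HarnessLib

/-!
# If EEL′ fails, an isolated extremal burst exists (crux `TypeIliouvilleNoTypeII`,
# stmt-NavierStokesRegularity-0056; rigidity residual EEL′ of the pressure-free eternal split)

Helper file (theorems only) — the single object a proof of EEL′ must kill, assembled from
`exists_extremal_of_ne_zero` (p483367), `exists_alphaLimit_zero_forward` (p488957) and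
`exists_omegaLimit_zero_forward` (forward quiescence):

* `exists_isolatedBurst_of_ne_zero` — if a member `v` of the EEL′ class (`‖v‖ ≤ N`, `A_ess, C, E ≤ I`,
  `I ≠ ∞`) does not vanish identically, then there is a member `W` of the same class which is
  EXTREMAL (`0 < ‖W(0,0)‖ = sup ‖v‖ ≥ ‖W‖` everywhere) and an ISOLATED BURST: along times
  `τ⁻_j → -∞` and `τ⁺_j → +∞`, `W(t + τ^±_j, y) → 0` for all `t ≥ 0`, `y`.

So EEL′ (hence, modulo S₁′, the hard core `NoTypeII`) ⇔ no isolated extremal burst exists in the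
energy class.  WHAT THIS IS NOT: not NS; EEL′ stays OPEN. [folklore]
-/

noncomputable section

-- the summit and its single problem share the name `NavierStokesRegularity` (D-0017 nested layout)
set_option linter.dupNamespace false

open Set Function Filter Topology MeasureTheory Metric
open scoped NNReal ENNReal

namespace Summit.NavierStokesRegularity.NavierStokesRegularity.Theorems.TypeIliouvilleNoTypeII.TypeIIZoom

open Literature.Analysis Literature.Analysis.FluidPDE

variable {v : ℝ → EuclideanSpace ℝ (Fin 3) → EuclideanSpace ℝ (Fin 3)}

/-- **A nonzero member of the EEL′ class yields an isolated extremal burst** in the same class.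
[cite: KochNadirashviliSereginSverak2009, Lemma 6.1 and Prop. 4.1 (arXiv:0709.3599 pp. 8, 11)] -/
theorem exists_isolatedBurst_of_ne_zero (hv : ContDiff ℝ (⊤ : ℕ∞) (uncurry v))
    (hdiv : ∀ t, VectorCalculus.IsDivFree (v t))
    (hmild : ∀ s t : ℝ, s < t → ∀ x, v t x = heatFlow (v s) (t - s) x - oseenDuhamel 1 s v v t x)
    {N : ℝ} (hbd : ∀ (t : ℝ) (x : EuclideanSpace ℝ (Fin 3)), ‖v t x‖ ≤ N) {I : ℝ≥0∞} (hI : I ≠ ⊤)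
    (hball : ∀ r : ℝ, 0 < r → ∀ z : ℝ × EuclideanSpace ℝ (Fin 3),
      cknAEss r z v ≤ I ∧ cknC r z v ≤ I ∧ cknE r z (fun s y => fderiv ℝ (v s) y) ≤ I)
    {t₀ : ℝ} {x₀ : EuclideanSpace ℝ (Fin 3)} (h0 : v t₀ x₀ ≠ 0) :
    ∃ W : ℝ → EuclideanSpace ℝ (Fin 3) → EuclideanSpace ℝ (Fin 3),
      ContDiff ℝ (⊤ : ℕ∞) (uncurry W) ∧ (∀ t, VectorCalculus.IsDivFree (W t)) ∧
      (∀ s t : ℝ, s < t → ∀ x, W t x = heatFlow (W s) (t - s) x - oseenDuhamel 1 s W W t x) ∧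
      (∀ t x, ‖W t x‖ ≤ N) ∧
      (∀ r : ℝ, 0 < r → ∀ z : ℝ × EuclideanSpace ℝ (Fin 3),
        cknAEss r z W ≤ I ∧ cknC r z W ≤ I ∧ cknE r z (fun s y => fderiv ℝ (W s) y) ≤ I) ∧
      ‖W 0 0‖ = (⨆ q : ℝ × EuclideanSpace ℝ (Fin 3), ‖v q.1 q.2‖) ∧ 0 < ‖W 0 0‖ ∧
      (∀ t x, ‖W t x‖ ≤ ‖W 0 0‖) ∧
      (∃ τ : ℕ → ℝ, Tendsto τ atTop atBot ∧
        ∀ t : ℝ, 0 ≤ t → ∀ y, Tendsto (fun j => W (t + τ j) y) atTop (𝓝 0)) ∧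
      (∃ τ : ℕ → ℝ, Tendsto τ atTop atTop ∧
        ∀ t : ℝ, 0 ≤ t → ∀ y, Tendsto (fun j => W (t + τ j) y) atTop (𝓝 0)) := by
  obtain ⟨-, -, W, hW, hWdiv, hWmild, hWbd, hWI, -, hsup, hpos, hext⟩ :=
    exists_extremal_of_ne_zero hv hdiv hmild hbd hball h0
  exact ⟨W, hW, hWdiv, hWmild, hWbd, hWI, hsup, hpos, hext,
    exists_alphaLimit_zero_forward hW hWdiv hWmild hWbd hI hWI,
    exists_omegaLimit_zero_forward hW hWdiv hWmild hWbd hI hWI⟩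

end Summit.NavierStokesRegularity.NavierStokesRegularity.Theorems.TypeIliouvilleNoTypeII.TypeIIZoom

end
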